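import Mathlib

/-!
# Cotangent bound for finite-dimensional local algebras (solo-informed, §7.11 (16.1))

For a local `k`-algebra `A` of finite dimension `m` over a field `k`, the Zariski cotangent space
`𝔪 / 𝔪²` has `k`-dimension at most `m - 1`.  Applied to `A = 𝕋_𝔪 / p` (`𝕋_𝔪` a local Hecke algebra,
finite free of rank `m` over `ℤ_p`, residue field `𝔽_p`) this is the inequality
`dim t_{𝕋_𝔪} ≤ rank 𝕋_𝔪 - 1` of §7.11 (16.1): a rank-two Hecke algebra has a one-dimensional
tangent space, so it cannot receive a deformation ring with two-dimensional tangent space isomorphically.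
-/

namespace Summit.Langlands.Langlands.Theorems

open Module IsLocalRing

/-- §7.11 (16.1): `dim_k (𝔪/𝔪²) + 1 ≤ dim_k A` for a finite-dimensional local `k`-algebra `A`. -/
theorem soloInformed_finrank_cotangent_succ_le (k A : Type*) [Field k] [CommRing A] [IsLocalRing A]
    [Algebra k A] [FiniteDimensional k A] :
    finrank k (maximalIdeal A).Cotangent + 1 ≤ finrank k A := by
  set m : Ideal A := maximalIdeal A with hm
  -- the maximal ideal is a finite-dimensional `k`-space
  haveI : Module.Finite k m :=
    Module.Finite.of_injective ((Submodule.subtype m).restrictScalars k) Subtype.val_injective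
  -- `𝔪 → 𝔪/𝔪²` is a `k`-linear surjection
  have h1 : finrank k m.Cotangent ≤ finrank k m :=
    LinearMap.finrank_le_finrank_of_surjective (f := m.toCotangent.restrictScalars k)
      m.toCotangent_surjective
  -- `𝔪` is a proper `k`-subspace of `A`
  have hne : m.restrictScalars k ≠ ⊤ := by
    intro h
    have h1mem : (1 : A) ∈ m.restrictScalars k := by rw [h]; exact Submodule.mem_top
    rw [Submodule.restrictScalars_mem] at h1mem
    exact (Ideal.ne_top_iff_one m).1 (Ideal.IsMaximal.ne_top (maximalIdeal.isMaximal A)) h1mem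
  have h2 : finrank k (m.restrictScalars k) < finrank k A :=
    Submodule.finrank_lt hne
  have h3 : finrank k (m.restrictScalars k) = finrank k m := rfl
  omega

/-- The form used in §7.11 (16.2): a local algebra of dimension at most two has cotangent
dimension at most one (e.g. `𝕋_𝔪/p` when `rank_{ℤ_p} 𝕋_𝔪 ≤ 2`). -/
theorem soloInformed_finrank_cotangent_le_one_of_finrank_le_two (k A : Type*) [Field k] [CommRing A]
    [IsLocalRing A] [Algebra k A] [FiniteDimensional k A] (h : finrank k A ≤ 2) :
    finrank k (maximalIdeal A).Cotangent ≤ 1 := by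
  have := soloInformed_finrank_cotangent_succ_le k A
  omega

/-- §7.11 (16.1), the kernel: `dim_k (𝔪/𝔪²) + dim_k 𝔪² = dim_k 𝔪`; hence equality in
`soloInformed_finrank_cotangent_succ_le` holds iff `𝔪² = 0` and the residue field is `k`. -/
theorem soloInformed_finrank_cotangent_add_finrank_sq (k A : Type*) [Field k] [CommRing A]
    [IsLocalRing A] [Algebra k A] [FiniteDimensional k A] :
    finrank k (maximalIdeal A).Cotangent + finrank k ↥((maximalIdeal A) ^ 2) =
      finrank k (maximalIdeal A) := by
  set m : Ideal A := maximalIdeal A with hm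
  haveI : Module.Finite k m :=
    Module.Finite.of_injective ((Submodule.subtype m).restrictScalars k) Subtype.val_injective
  let f : m →ₗ[k] m.Cotangent := m.toCotangent.restrictScalars k
  have hf : Function.Surjective f := m.toCotangent_surjective
  have hrn := LinearMap.finrank_range_add_finrank_ker f
  rw [LinearMap.range_eq_top.2 hf, finrank_top] at hrn
  -- identify `ker f` with `𝔪²` as `k`-spaces
  have hinj : Function.Injective ((Submodule.subtype m).restrictScalars k) := Subtype.val_injective
  let e := Submodule.equivMapOfInjective _ hinj (LinearMap.ker f)
  have hmap : (LinearMap.ker f).map ((Submodule.subtype m).restrictScalars k) =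
      (m ^ 2).restrictScalars k := by
    ext x
    simp only [Submodule.mem_map, LinearMap.mem_ker, Submodule.restrictScalars_mem,
      LinearMap.coe_restrictScalars, Submodule.coe_subtype]
    constructor
    · rintro ⟨y, hy, rfl⟩
      exact (m.toCotangent_eq_zero y).1 hy
    · intro hx
      have hxm : x ∈ m := Ideal.pow_le_self two_ne_zero hx
      exact ⟨⟨x, hxm⟩, (m.toCotangent_eq_zero ⟨x, hxm⟩).2 hx, rfl⟩
  have hker : finrank k (LinearMap.ker f) = finrank k ↥((m ^ 2).restrictScalars k) := by
    rw [← hmap]; exact e.finrank_eq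
  have h3 : finrank k ↥((m ^ 2).restrictScalars k) = finrank k ↥(m ^ 2) := rfl
  omega

end Summit.Langlands.Langlands.Theorems
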